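import Summits.QuantumFields.YangMills.Theorems.SandwichVariancePinchingQuadraticVarianceCeiling
import Summits.QuantumFields.YangMills.Theorems.SandwichVariancePinchingQuadraticVarianceFloor
import Summits.QuantumFields.YangMills.Theorems.SandwichVariancePinchingComparisonOfPinchings

/-!
# Route `LogConcaveChart` — crux `QuadraticCovarianceComparison` (stmt-QuantumFields-26240) PROVED UNCONDITIONALLY

The Gibbs-vs-Gaussian covariance comparison for quadratic(+linear) observables under the `(1 ± δ)H₀` second-difference
sandwich with centring, `|Cov_ν(f,g) − rC| ≤ C·δ·√(rV_f·rV_g)` with `C, δ₀` independent of the dimension — by the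
PROVED ceiling (`sandwichVariancePinching_quadraticVarianceCeiling_proof`, C = 26) and floor
(`sandwichVariancePinching_quadraticVarianceFloor_proof`, C = 2) of route `SandwichVariancePinching` through its
landed polarisation + scaling glue `SandwichVariancePinching.quadraticCovarianceComparison_of_pinchings` (p645572).
Previously this crux was known in the tree only MODULO the named fact `Caffarelli2000_sandwichBrenierMap`
(`logConcaveChart_quadraticCovarianceComparison_of_caffarelli`); this proof uses no optimal transport and no
Helffer–Sjöstrand representation — only affine-score integration by parts and first-order Brascamp–Lieb
(Brascamp–Lieb 1976, Thm 4.1, proved in the tree).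

HONEST SCOPE.  Free-hands work of the LEAD seat of crux stmt-QuantumFields-22884 (cell ym-idea-1).  Closes ONE crux
(rank 3) of route `LogConcaveChart`; its cruxes `UnitScaleChart` (26931) and `SkewAtChartUnit` (26932), the route
thesis, rung R2a (`BalabanLadder.NT`) and every summit statement remain OPEN; the Yang–Mills mass gap is NOT proved.
-/

noncomputable section

namespace Summit.QuantumFields.YangMills.Theorems

/-- **Crux `QuadraticCovarianceComparison` (stmt-QuantumFields-26240)**, unconditional. [folklore] -/
theorem logConcaveChart_quadraticCovarianceComparison_proof :
    Summit.QuantumFields.YangMills.Theses.LogConcaveChart.QuadraticCovarianceComparison :=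
  SandwichVariancePinching.quadraticCovarianceComparison_of_pinchings
    sandwichVariancePinching_quadraticVarianceCeiling_proof sandwichVariancePinching_quadraticVarianceFloor_proof

end Summit.QuantumFields.YangMills.Theorems

end
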